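import Mathlib
import Summits.NavierStokesRegularity.NavierStokesRegularity.Theorems.LerayQuarterDissipationFiniteDissipationLiouvilleEndpointScheme
import HarnessLib

/-!
# Crux `FiniteDissipationLiouville` (stmt-NavierStokesRegularity-22144): THE ANTITONE-ENSTROPHY
# ENDPOINT SCHEME, slack form

Theorems file of route `LerayQuarterDissipation` (lead prover g18; `--supports` the crux; sequel of
`…EndpointScheme`). Navier–Stokes regularity is NOT proved by anything here; no summit is.

The scheme `…EndpointScheme.eq_zero_of_antitone_scheme` asks for (iii) antitone global similarity
enstrophy and (iv) «constant enstrophy ⇒ zero» on the enveloped members with the property `P`.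
Both follow from POINTWISE information on the slack density
`σ = ‖curl Ω‖² + ¼‖Ω‖² − ⟪U, Ω × curl Ω⟫` of the global budget `Z' = −2∫σ`
(`…CrossFlowDss.hasDerivAt_enstrophy_eq_neg_two_integral_slack`, lead g17):

* `antitone_and_const_of_slack` — `σ ≥ 0` pointwise gives (iii); if moreover «`σ ≡ 0` on a slice ⇒
  the slice is irrotational» then constant `Z` forces `∫σ ≡ 0`, hence `σ ≡ 0` (continuous,
  nonnegative, integrable), hence every slice irrotational, hence `V ≡ 0` (curl-free bounded
  divergence-free slices are constant; the gauge) — this is (iv);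
* **`eq_zero_of_slack_scheme`** — the scheme in slack form: rescaling-invariant + KNSS-closed +
  slack `≥ 0` + slice rigidity ⇒ every enveloped KNSS-gauge Type-I field with `P` vanishes.

HONEST FRAMING. Bookkeeping about HYPOTHETICAL objects (g17's argument, abstracted); removes nothing
from the catalogued DSS wall by itself. Nothing here bears on Navier–Stokes regularity or blow-up.

References: Koch–Nadirashvili–Seregin–Šverák, Acta Math. 203 (2009) §4; folklore energy method.
-/

noncomputable section

set_option linter.dupNamespace false

namespace Summit.NavierStokesRegularity.NavierStokesRegularity.Theorems.FiniteDissipationLiouville.EndpointScheme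

open MeasureTheory Set Filter Topology Metric InnerProductSpace Function Real
open scoped RealInnerProductSpace ContDiff
open Literature.Analysis Literature.Analysis.FluidPDE
open Summit.NavierStokesRegularity.NavierStokesRegularity.Theorems
open Summit.NavierStokesRegularity.NavierStokesRegularity.Theorems.GaussianGap
open Summit.NavierStokesRegularity.NavierStokesRegularity.Theorems.SimilarityEnstrophy
open Summit.NavierStokesRegularity.NavierStokesRegularity.Theorems.SmallDissipationGap
open Summit.NavierStokesRegularity.NavierStokesRegularity.Theorems.RecurrentReductionD
open Summit.NavierStokesRegularity.NavierStokesRegularity.Theorems.FiniteDissipationLiouville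
open Summit.NavierStokesRegularity.NavierStokesRegularity.Theorems.FiniteDissipationLiouville.CrossFlow

section Scheme

variable {C : ℝ}

/-- **Slack form of hypotheses (iii)–(iv).** If, for every enveloped member with `P`, the slack
density `σ = ‖curl Ω‖² + ¼‖Ω‖² − ⟪U, Ω × curl Ω⟫` of the global similarity-enstrophy budget
(`Z' = −2∫σ`, `…CrossFlowDss.hasDerivAt_enstrophy_eq_neg_two_integral_slack`) is pointwise
nonnegative, and its pointwise vanishing on a slice forces that slice's vorticity to vanish, then
(iii) the enstrophy is antitone and (iv) constant enstrophy kills the member. [folklore] -/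
theorem antitone_and_const_of_slack
    {P : (ℝ → EuclideanSpace ℝ (Fin 3) → EuclideanSpace ℝ (Fin 3)) → Prop}
    (hnonneg : ∀ (V : ℝ → EuclideanSpace ℝ (Fin 3) → EuclideanSpace ℝ (Fin 3)),
      IsTypeIAncientMild C V → HasTypeIDecay C V → P V → ∀ (s : ℝ) (y : EuclideanSpace ℝ (Fin 3)),
      0 ≤ ‖curl (lerayVorticity V s) y‖ ^ 2 + (1 / 4) * ‖lerayVorticity V s y‖ ^ 2 -
        ⟪lerayOrbit V s y, cross (lerayVorticity V s y) (curl (lerayVorticity V s) y)⟫)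
    (hrigid : ∀ (V : ℝ → EuclideanSpace ℝ (Fin 3) → EuclideanSpace ℝ (Fin 3)),
      IsTypeIAncientMild C V → HasTypeIDecay C V → P V → ∀ s : ℝ,
      (∀ y, ‖curl (lerayVorticity V s) y‖ ^ 2 + (1 / 4) * ‖lerayVorticity V s y‖ ^ 2 -
        ⟪lerayOrbit V s y, cross (lerayVorticity V s y) (curl (lerayVorticity V s) y)⟫ = 0) →
      ∀ y, lerayVorticity V s y = 0) :
    (∀ (V : ℝ → EuclideanSpace ℝ (Fin 3) → EuclideanSpace ℝ (Fin 3)),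
      IsTypeIAncientMild C V → HasTypeIDecay C V → P V →
      Antitone fun σ => ∫ y, ‖lerayVorticity V σ y‖ ^ 2) ∧
    (∀ (V : ℝ → EuclideanSpace ℝ (Fin 3) → EuclideanSpace ℝ (Fin 3)),
      IsTypeIAncientMild C V → HasTypeIDecay C V → P V →
      (∀ s s' : ℝ, (∫ y, ‖lerayVorticity V s y‖ ^ 2) = ∫ y, ‖lerayVorticity V s' y‖ ^ 2) →
      ∀ t < 0, ∀ x, V t x = 0) := by
  refine ⟨fun V hV hdec hP => ?_, fun V hV hdec hP hconst => ?_⟩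
  · have hd := fun s => hasDerivAt_enstrophy_eq_neg_two_integral_slack hV hdec s
    refine antitone_of_deriv_nonpos (fun s => (hd s).differentiableAt) fun s => ?_
    rw [(hd s).deriv]
    have hσ : 0 ≤ ∫ y, (‖curl (lerayVorticity V s) y‖ ^ 2 + (1 / 4) * ‖lerayVorticity V s y‖ ^ 2 -
        ⟪lerayOrbit V s y, cross (lerayVorticity V s y) (curl (lerayVorticity V s) y)⟫) :=
      integral_nonneg fun y => hnonneg V hV hdec hP s y
    linarith
  · -- adapted from Theorems/…CrossFlowDss.lean (`eq_zero_of_crossFlow_le_one_of_enstrophy_periodic`)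
    obtain ⟨C₁, C₂, C₃, hD1, hD2, -⟩ := IsTypeIAncientMild.gaugeBounds_of_hasTypeIDecay hV hdec
    -- the slack integral vanishes at every time
    have hslack : ∀ s, ∫ y, (‖curl (lerayVorticity V s) y‖ ^ 2 + (1 / 4) * ‖lerayVorticity V s y‖ ^ 2 -
        ⟪lerayOrbit V s y, cross (lerayVorticity V s y) (curl (lerayVorticity V s) y)⟫) = 0 := by
      intro s
      have hd := hasDerivAt_enstrophy_eq_neg_two_integral_slack hV hdec s
      have hc : HasDerivAt (fun σ => ∫ y, ‖lerayVorticity V σ y‖ ^ 2) 0 s := by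
        have : (fun σ => ∫ y, ‖lerayVorticity V σ y‖ ^ 2) =
            fun _ => ∫ y, ‖lerayVorticity V 0 y‖ ^ 2 := funext fun σ => hconst σ 0
        rw [this]; exact hasDerivAt_const _ _
      have := hd.unique hc
      linarith
    -- so the slack density vanishes identically on every slice
    have hΩ0 : ∀ s y, lerayVorticity V s y = 0 := by
      intro s
      have iC := integrable_norm_curl_lerayVorticity_sq hV hD2 s
      have iZ := integrable_norm_lerayVorticity_sq hV hD1 s
      have iΛ := integrable_inner_lerayOrbit_lamb hV hD1 hD2 s
      have hint : Integrable fun y => ‖curl (lerayVorticity V s) y‖ ^ 2 +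
          (1 / 4) * ‖lerayVorticity V s y‖ ^ 2 -
          ⟪lerayOrbit V s y, cross (lerayVorticity V s y) (curl (lerayVorticity V s) y)⟫ :=
        (iC.add (iZ.const_mul _)).sub iΛ
      have hΩinf := contDiff_lerayVorticity_slice hV s
      have hΩc : ContDiff ℝ 1 (lerayVorticity V s) := hΩinf.of_le (by norm_cast)
      have hC1 : ContDiff ℝ 1 (curl (lerayVorticity V s)) :=
        contDiff_curl (n := 1) (hΩinf.of_le (by norm_cast))
      have hCc : Continuous (curl (lerayVorticity V s)) := hC1.continuous
      have hUc : Continuous (lerayOrbit V s) :=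
        (contDiff_lerayOrbit_slice_of_typeI hV s (n := 1) (by norm_cast)).continuous
      have hXc : Continuous fun y => cross (lerayVorticity V s y) (curl (lerayVorticity V s) y) :=
        ((crossCLM.contDiff.comp hΩc).clm_apply hC1).continuous
      have hcont : Continuous fun y => ‖curl (lerayVorticity V s) y‖ ^ 2 +
          (1 / 4) * ‖lerayVorticity V s y‖ ^ 2 -
          ⟪lerayOrbit V s y, cross (lerayVorticity V s y) (curl (lerayVorticity V s) y)⟫ :=
        ((hCc.norm.pow 2).add (continuous_const.mul (hΩc.continuous.norm.pow 2))).sub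
          (hUc.inner hXc)
      have hae := (integral_eq_zero_iff_of_nonneg (fun y => hnonneg V hV hdec hP s y) hint).1
        (hslack s)
      have hev := (hcont.ae_eq_iff_eq (μ := volume) continuous_const).1 hae
      exact hrigid V hV hdec hP s (fun y => congrFun hev y)
    -- `V ≡ 0`
    have hcurl : ∀ t < 0, ∀ x, curl (V t) x = 0 := by
      intro t ht x
      set s : ℝ := -Real.log (-t) with hs
      have hts : -Real.exp (-s) = t := by
        rw [hs, neg_neg, Real.exp_log (neg_pos.2 ht), neg_neg]
      have h := hΩ0 s ((Real.exp (-s / 2))⁻¹ • x)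
      rw [lerayVorticity_apply, curl_lerayOrbit, smul_smul,
        mul_inv_cancel₀ (Real.exp_pos _).ne', one_smul, hts, smul_eq_zero] at h
      exact h.resolve_left (Real.exp_pos _).ne'
    have hconstV : ∀ t < 0, ∀ x, V t x = V t 0 := fun t ht x =>
      eq_of_curl_eq_zero_of_isDivFree_of_bounded ((hV.contDiff_slice ht).of_le (by norm_cast))
        (hcurl t ht) (hV.isDivFree ht) (fun z => hV.norm_le ht z) x 0
    exact fun t ht x => hV.eq_zero_of_slice_const (b := fun t => V t 0) hconstV ht x

/-- **THE SCHEME IN SLACK FORM.** A rescaling-invariant, KNSS-closed property `P` under which the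
slack density of the global similarity-enstrophy budget is pointwise nonnegative on every enveloped
member, with the rigidity «slack density `≡ 0` on a slice ⇒ the slice is irrotational», kills every
KNSS-gauge Type-I field with a Type-I envelope. [folklore energy method + KNSS compactness] -/
theorem eq_zero_of_slack_scheme
    {P : (ℝ → EuclideanSpace ℝ (Fin 3) → EuclideanSpace ℝ (Fin 3)) → Prop}
    (hscale : ∀ (V : ℝ → EuclideanSpace ℝ (Fin 3) → EuclideanSpace ℝ (Fin 3)) (c : ℝ), 0 < c →
      P V → P (nsRescale c V))
    (hclosed : ∀ (u : ℕ → ℝ → EuclideanSpace ℝ (Fin 3) → EuclideanSpace ℝ (Fin 3))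
        (W : ℝ → EuclideanSpace ℝ (Fin 3) → EuclideanSpace ℝ (Fin 3)),
      (∀ j, IsTypeIAncientMild C (u j)) → (∀ j, HasTypeIDecay C (u j)) → (∀ j, P (u j)) →
      IsTypeIAncientMild C W →
      (∀ n : ℕ, TendstoUniformlyOn (fun j z => u j z.1 z.2) (fun z => W z.1 z.2) atTop
        (Icc (-((n : ℝ) + 2)) (-(1 / ((n : ℝ) + 2))) ×ˢ
          closedBall (0 : EuclideanSpace ℝ (Fin 3)) ((n : ℝ) + 2))) →
      (∀ t < 0, ∀ x, Tendsto (fun j => u j t x) atTop (𝓝 (W t x))) →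
      (∀ t < 0, ∀ x, Tendsto (fun j => fderiv ℝ (u j t) x) atTop (𝓝 (fderiv ℝ (W t) x))) →
      P W)
    (hnonneg : ∀ (V : ℝ → EuclideanSpace ℝ (Fin 3) → EuclideanSpace ℝ (Fin 3)),
      IsTypeIAncientMild C V → HasTypeIDecay C V → P V → ∀ (s : ℝ) (y : EuclideanSpace ℝ (Fin 3)),
      0 ≤ ‖curl (lerayVorticity V s) y‖ ^ 2 + (1 / 4) * ‖lerayVorticity V s y‖ ^ 2 -
        ⟪lerayOrbit V s y, cross (lerayVorticity V s y) (curl (lerayVorticity V s) y)⟫)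
    (hrigid : ∀ (V : ℝ → EuclideanSpace ℝ (Fin 3) → EuclideanSpace ℝ (Fin 3)),
      IsTypeIAncientMild C V → HasTypeIDecay C V → P V → ∀ s : ℝ,
      (∀ y, ‖curl (lerayVorticity V s) y‖ ^ 2 + (1 / 4) * ‖lerayVorticity V s y‖ ^ 2 -
        ⟪lerayOrbit V s y, cross (lerayVorticity V s y) (curl (lerayVorticity V s) y)⟫ = 0) →
      ∀ y, lerayVorticity V s y = 0)
    {V : ℝ → EuclideanSpace ℝ (Fin 3) → EuclideanSpace ℝ (Fin 3)}
    (hV : IsTypeIAncientMild C V) (hdec : HasTypeIDecay C V) (hP : P V) :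
    ∀ t < 0, ∀ x, V t x = 0 := by
  obtain ⟨hanti, hconst⟩ := antitone_and_const_of_slack (C := C) hnonneg hrigid
  exact eq_zero_of_antitone_scheme hscale hclosed hanti hconst hV hdec hP

end Scheme

end Summit.NavierStokesRegularity.NavierStokesRegularity.Theorems.FiniteDissipationLiouville.EndpointScheme

end
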